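import Mathlib
import Literature.Analysis.ODE.RegularSingularAnalyticBranchSolution
import HarnessLib

/-!
# The analytic branch at a regular singular point, scalar second-order form:
# `x y″ + p(x) y′ + q(x) y = 0` with `p`, `q` analytic at `0`

Topic `Literature/Analysis/ODE` (namespace `Literature.Analysis.ODE`). The classical Frobenius theorem for the
exponent-`0` branch of a scalar equation with a singularity of the first kind at `x = 0`,

  `x y″(x) + p(x) y′(x) + q(x) y(x) = 0`,  `p(x) = Σ pₖ xᵏ`,  `q(x) = Σ qₖ xᵏ`  (`‖x‖ < ρ₀`),

indicial exponents `{0, 1 − p₀}`: if NO POSITIVE INTEGER `n` has `n + p₀ = 0` — quantitatively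
`μ n ≤ ‖n + p₀‖` for `n ≥ 1` — then for every pair `(y₀, y₁)` with the order-`0` compatibility
`q₀ y₀ + p₀ y₁ = 0` there is a solution HOLOMORPHIC on a disc `‖x‖ < ρ` with `y(0) = y₀`, `y′(0) = y₁`
(`exists_analyticBranch_scalar`). It is obtained from the vector theorem
`IsFrobeniusData.analyticBranch` of `RegularSingularAnalyticBranchSolution.lean` applied to the first-order
system for `v = (y, y′)`: `x v′ = M(x) v`, `M(x) = [[0, x], [−q(x), −p(x)]]`, whose residue
`M₀ = [[0, 0], [−q₀, −p₀]]` has eigenvalues `{0, −p₀}`; the inverses `Rₙ = (n − M₀)⁻¹` are written down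
explicitly (`scalarBranchR`) with `‖Rₙ‖ ≤ c/n`, `c = max 1 ((‖q₀‖ + 1)/μ)`.

* `scalarBranchM pc qc k` — the coefficient operators `Mₖ` on `ℂ × ℂ`; `scalarBranchR pc qc n` — the inverses;
* `isFrobeniusData_scalar` — the hypotheses of the vector theorem are met;
* `exists_analyticBranch_scalar` — THE THEOREM: `ρ > 0` and `y, y′ : ℂ → ℂ` complex-differentiable on
  `‖x‖ < ρ` with `y 0 = y₀`, `y′ 0 = y₁`, `HasDerivAt y (y′ x) x` for `0 < ‖x‖ < ρ` and
  `x · (y′)′(x) + p(x) y′(x) + q(x) y(x) = 0` on `‖x‖ < ρ`.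

Typical use: the solution of a Fuchsian equation `(x − x₀)(…) y″ + … = 0` which is analytic at the singular
point `x₀` (e.g. the horizon-regular branch of the radial Teukolsky / confluent Heun equation at `r = r₊`,
where `p₀ = 1 + 2ξ`, `ξ ∈ iℝ`, so `‖n + p₀‖ ≥ n + 1`).

## References
* E. A. Coddington, N. Levinson, *Theory of Ordinary Differential Equations*, McGraw–Hill 1955, Ch. 4 §§3–4, 8
  (second-order equations with a regular singular point). Key `CoddingtonLevinson1955`.
* P. Hartman, *Ordinary Differential Equations*, SIAM Classics 38 (2002), Ch. IV §12. Key `Hartman2002`.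
-/

noncomputable section

open Finset Filter Metric
open scoped Topology NNReal ENNReal

namespace Literature.Analysis.ODE

/-! ### The first-order system of `x y″ + p y′ + q y = 0` -/

/-- The coefficient operators `Mₖ` of the system `x v′ = (Σ xᵏ Mₖ) v`, `v = (y, y′)`, equivalent to
`x y″ + p y′ + q y = 0`: `M₁ = [[0, 1], [−q₁, −p₁]]`, `Mₖ = [[0, 0], [−qₖ, −pₖ]]` (`k ≠ 1`).
[cite: CoddingtonLevinson1955, Ch. 4 §8] -/
def scalarBranchM (pc qc : ℕ → ℂ) (k : ℕ) : ℂ × ℂ →L[ℂ] ℂ × ℂ :=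
  (if k = 1 then ContinuousLinearMap.snd ℂ ℂ ℂ else 0).prod
    (-(qc k) • ContinuousLinearMap.fst ℂ ℂ ℂ - (pc k) • ContinuousLinearMap.snd ℂ ℂ ℂ)

/-- The inverse `Rₙ = (n − M₀)⁻¹ = (1/(n(n + p₀))) [[n + p₀, 0], [−q₀, n]]` (meaningful when
`n (n + p₀) ≠ 0`). [cite: CoddingtonLevinson1955, Ch. 4 §8] -/
def scalarBranchR (pc qc : ℕ → ℂ) (n : ℕ) : ℂ × ℂ →L[ℂ] ℂ × ℂ :=
  ((n : ℂ)⁻¹ • ContinuousLinearMap.fst ℂ ℂ ℂ).prod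
    (((n : ℂ) * ((n : ℂ) + pc 0))⁻¹ •
      (-(qc 0) • ContinuousLinearMap.fst ℂ ℂ ℂ + (n : ℂ) • ContinuousLinearMap.snd ℂ ℂ ℂ))

section System

variable (pc qc : ℕ → ℂ)

/-- `Mₖ (w₁, w₂) = ([k = 1] w₂, −qₖ w₁ − pₖ w₂)`. [folklore] -/
@[simp] theorem scalarBranchM_apply (k : ℕ) (w : ℂ × ℂ) :
    scalarBranchM pc qc k w = (if k = 1 then w.2 else 0, -(qc k) * w.1 - pc k * w.2) := by
  rcases eq_or_ne k 1 with rfl | hk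
  · simp [scalarBranchM]
  · simp [scalarBranchM, hk]

/-- `Rₙ (w₁, w₂) = (w₁/n, (−q₀ w₁ + n w₂)/(n(n + p₀)))`. [folklore] -/
@[simp] theorem scalarBranchR_apply (n : ℕ) (w : ℂ × ℂ) :
    scalarBranchR pc qc n w =
      ((n : ℂ)⁻¹ * w.1, ((n : ℂ) * ((n : ℂ) + pc 0))⁻¹ * (-(qc 0) * w.1 + (n : ℂ) * w.2)) := by
  change ((n : ℂ)⁻¹ • w.1, ((n : ℂ) * ((n : ℂ) + pc 0))⁻¹ • (-(qc 0) • w.1 + (n : ℂ) • w.2)) = _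
  simp only [smul_eq_mul]

/-- `‖Mₖ‖ ≤ [k = 1] + ‖qₖ‖ + ‖pₖ‖` in the form used below: `‖Mₖ‖ ≤ max [k = 1] (‖qₖ‖ + ‖pₖ‖)`. [folklore] -/
theorem norm_scalarBranchM_le (k : ℕ) :
    ‖scalarBranchM pc qc k‖ ≤ max (if k = 1 then 1 else 0) (‖qc k‖ + ‖pc k‖) := by
  rw [scalarBranchM, ContinuousLinearMap.opNorm_prod, Prod.norm_mk]
  refine max_le_max ?_ ?_
  · split_ifs
    · exact ContinuousLinearMap.norm_snd_le ℂ ℂ ℂ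
    · simp
  · refine (norm_sub_le _ _).trans (add_le_add ?_ ?_)
    · rw [norm_smul, norm_neg]
      exact mul_le_of_le_one_right (norm_nonneg _) (ContinuousLinearMap.norm_fst_le ℂ ℂ ℂ)
    · rw [norm_smul]
      exact mul_le_of_le_one_right (norm_nonneg _) (ContinuousLinearMap.norm_snd_le ℂ ℂ ℂ)

/-- `Rₙ` is a right inverse of `n − M₀` whenever `n ≠ 0` and `n + p₀ ≠ 0`. [folklore] -/
theorem scalarBranchR_rightInverse {n : ℕ} (hn : n ≠ 0) (hp : (n : ℂ) + pc 0 ≠ 0) (w : ℂ × ℂ) :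
    (n : ℂ) • scalarBranchR pc qc n w - scalarBranchM pc qc 0 (scalarBranchR pc qc n w) = w := by
  have hn' : (n : ℂ) ≠ 0 := Nat.cast_ne_zero.2 hn
  ext
  · simp only [scalarBranchR_apply, scalarBranchM_apply, Prod.smul_fst, Prod.fst_sub, smul_eq_mul]
    simp only [zero_ne_one, ↓reduceIte, sub_zero]
    field_simp
  · simp only [scalarBranchR_apply, scalarBranchM_apply, Prod.smul_snd, Prod.snd_sub, smul_eq_mul]
    field_simp
    ring

/-- `Rₙ` is a left inverse of `n − M₀` whenever `n ≠ 0` and `n + p₀ ≠ 0`. [folklore] -/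
theorem scalarBranchR_leftInverse {n : ℕ} (hn : n ≠ 0) (hp : (n : ℂ) + pc 0 ≠ 0) (w : ℂ × ℂ) :
    scalarBranchR pc qc n ((n : ℂ) • w - scalarBranchM pc qc 0 w) = w := by
  have hn' : (n : ℂ) ≠ 0 := Nat.cast_ne_zero.2 hn
  ext
  · simp only [scalarBranchR_apply, scalarBranchM_apply, Prod.smul_fst, Prod.fst_sub, smul_eq_mul]
    simp only [zero_ne_one, ↓reduceIte, sub_zero]
    field_simp
  · simp only [scalarBranchR_apply, scalarBranchM_apply, Prod.smul_fst, Prod.fst_sub, Prod.smul_snd, Prod.snd_sub,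
      smul_eq_mul]
    simp only [zero_ne_one, ↓reduceIte, sub_zero]
    field_simp
    ring

/-- THE RESOLVENT BOUND: if `μ n ≤ ‖n + p₀‖` (`μ > 0`, `n ≥ 1`) then `‖Rₙ‖ ≤ max 1 ((‖q₀‖ + 1)/μ) / n`.
[cite: CoddingtonLevinson1955, Ch. 4 §3] -/
theorem norm_scalarBranchR_le {μ : ℝ} (hμ : 0 < μ) {n : ℕ} (hn : 1 ≤ n) (hres : μ * n ≤ ‖(n : ℂ) + pc 0‖) :
    ‖scalarBranchR pc qc n‖ ≤ max 1 ((‖qc 0‖ + 1) / μ) / n := by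
  have hn0 : (0 : ℝ) < n := by exact_mod_cast hn
  have hn1 : (1 : ℝ) ≤ n := by exact_mod_cast hn
  have hP : 0 < ‖(n : ℂ) + pc 0‖ := lt_of_lt_of_le (by positivity) hres
  refine ContinuousLinearMap.opNorm_le_bound _ (by positivity) fun w => ?_
  rw [scalarBranchR_apply, Prod.norm_mk]
  have hw1 : ‖w.1‖ ≤ ‖w‖ := norm_fst_le w
  have hw2 : ‖w.2‖ ≤ ‖w‖ := norm_snd_le w
  have hw0 : 0 ≤ ‖w‖ := norm_nonneg w
  refine max_le ?_ ?_
  · rw [norm_mul, norm_inv, Complex.norm_natCast]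
    calc (n : ℝ)⁻¹ * ‖w.1‖ ≤ (n : ℝ)⁻¹ * ‖w‖ := mul_le_mul_of_nonneg_left hw1 (by positivity)
      _ = 1 / n * ‖w‖ := by ring
      _ ≤ max 1 ((‖qc 0‖ + 1) / μ) / n * ‖w‖ :=
          mul_le_mul_of_nonneg_right (div_le_div_of_nonneg_right (le_max_left _ _) hn0.le) hw0
  · rw [norm_mul, norm_inv, norm_mul, Complex.norm_natCast]
    have hnum : ‖-(qc 0) * w.1 + (n : ℂ) * w.2‖ ≤ (‖qc 0‖ + n) * ‖w‖ := by
      calc ‖-(qc 0) * w.1 + (n : ℂ) * w.2‖ ≤ ‖-(qc 0) * w.1‖ + ‖(n : ℂ) * w.2‖ := norm_add_le _ _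
        _ = ‖qc 0‖ * ‖w.1‖ + n * ‖w.2‖ := by rw [norm_mul, norm_neg, norm_mul, Complex.norm_natCast]
        _ ≤ ‖qc 0‖ * ‖w‖ + n * ‖w‖ := add_le_add (mul_le_mul_of_nonneg_left hw1 (norm_nonneg _))
            (mul_le_mul_of_nonneg_left hw2 hn0.le)
        _ = (‖qc 0‖ + n) * ‖w‖ := by ring
    calc ((n : ℝ) * ‖(n : ℂ) + pc 0‖)⁻¹ * ‖-(qc 0) * w.1 + (n : ℂ) * w.2‖
        ≤ ((n : ℝ) * (μ * n))⁻¹ * ((‖qc 0‖ + n) * ‖w‖) := by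
          refine mul_le_mul ?_ hnum (norm_nonneg _) (by positivity)
          exact inv_anti₀ (by positivity) (mul_le_mul_of_nonneg_left hres hn0.le)
      _ = ((‖qc 0‖ + n) / (μ * n)) / n * ‖w‖ := by
          field_simp
      _ ≤ max 1 ((‖qc 0‖ + 1) / μ) / n * ‖w‖ := by
          refine mul_le_mul_of_nonneg_right (div_le_div_of_nonneg_right ?_ hn0.le) hw0
          refine le_max_of_le_right ?_
          rw [div_le_div_iff₀ (by positivity) hμ]
          have h5 : ‖qc 0‖ * μ * 1 ≤ ‖qc 0‖ * μ * n :=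
            mul_le_mul_of_nonneg_left hn1 (mul_nonneg (norm_nonneg _) hμ.le)
          nlinarith [h5]

/-- The hypotheses of the vector Frobenius theorem are met by the system of `x y″ + p y′ + q y = 0`:
`‖Mₖ‖ ≤ (2K + a⁻¹) aᵏ` (`k ≥ 1`), `Rₙ` a right inverse with `‖Rₙ‖ ≤ c/n`, and the compatibility
`M₀ (y₀, y₁) = 0 ⟺ q₀ y₀ + p₀ y₁ = 0`. [cite: CoddingtonLevinson1955, Ch. 4 §§3–4] -/
theorem isFrobeniusData_scalar {a K μ : ℝ} (ha : 0 < a) (hK : 0 ≤ K) (hμ : 0 < μ)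
    (hpc : ∀ k : ℕ, 1 ≤ k → ‖pc k‖ ≤ K * a ^ k) (hqc : ∀ k : ℕ, 1 ≤ k → ‖qc k‖ ≤ K * a ^ k)
    (hres : ∀ n : ℕ, 1 ≤ n → μ * n ≤ ‖(n : ℂ) + pc 0‖) {y₀ y₁ : ℂ} (h0 : qc 0 * y₀ + pc 0 * y₁ = 0) :
    IsFrobeniusData (𝕜 := ℂ) (scalarBranchM pc qc) (fun _ => 0) (scalarBranchR pc qc) (y₀, y₁) a (2 * K + a⁻¹) 0
      (max 1 ((‖qc 0‖ + 1) / μ)) where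
  a_nonneg := ha.le
  K_nonneg := by positivity
  G_nonneg := le_rfl
  c_nonneg := by positivity
  norm_M_le k hk := by
    refine (norm_scalarBranchM_le pc qc k).trans (max_le ?_ ?_)
    · split_ifs with h1
      · subst h1
        rw [pow_one, add_mul, inv_mul_cancel₀ ha.ne']
        nlinarith
      · positivity
    · calc ‖qc k‖ + ‖pc k‖ ≤ K * a ^ k + K * a ^ k := add_le_add (hqc k hk) (hpc k hk)
        _ = 2 * K * a ^ k := by ring
        _ ≤ (2 * K + a⁻¹) * a ^ k := by
            refine mul_le_mul_of_nonneg_right ?_ (pow_nonneg ha.le k)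
            linarith [inv_pos.2 ha]
  norm_g_le k _ := by simp
  rightInverse n hn w := by
    have hP : 0 < ‖(n : ℂ) + pc 0‖ := lt_of_lt_of_le (by positivity) (hres n hn)
    exact scalarBranchR_rightInverse pc qc (by omega) (norm_pos_iff.1 hP) w
  norm_R_le n hn := norm_scalarBranchR_le pc qc hμ hn (hres n hn)
  compat := by
    rw [scalarBranchM_apply, add_zero, Prod.mk_eq_zero]
    simp only [zero_ne_one, ↓reduceIte, true_and]
    linear_combination -h0

end System

/-! ### The theorem -/

/-- **THE ANALYTIC BRANCH OF `x y″ + p(x) y′ + q(x) y = 0` (Frobenius, exponent `0`).** Let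
`p(x) = Σ pₖ xᵏ`, `q(x) = Σ qₖ xᵏ` on `‖x‖ < ρ₀` with `‖pₖ‖, ‖qₖ‖ ≤ K aᵏ` (`k ≥ 1`, `a > 0`), and assume the
non-resonance `μ n ≤ ‖n + p₀‖` for all `n ≥ 1` (`μ > 0`; the second indicial exponent `1 − p₀` is not an
integer `≥ 2`). Then for all `y₀, y₁` with `q₀ y₀ + p₀ y₁ = 0` there are `ρ > 0` and `y, y′ : ℂ → ℂ`,
complex-differentiable on the disc `‖x‖ < ρ` (hence holomorphic there), with `y 0 = y₀`, `y′ 0 = y₁`,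
`HasDerivAt y (y′ x) x` for `0 < ‖x‖ < ρ`, and `x · deriv y′ x + p x · y′ x + q x · y x = 0` for `‖x‖ < ρ`.
[cite: CoddingtonLevinson1955, Ch. 4 §8 (Thm. 4.1 ff.)] -/
theorem exists_analyticBranch_scalar {pc qc : ℕ → ℂ} {p q : ℂ → ℂ} {a K μ ρ₀ : ℝ} (ha : 0 < a)
    (hK : 0 ≤ K) (hμ : 0 < μ) (hρ₀ : 0 < ρ₀)
    (hpc : ∀ k : ℕ, 1 ≤ k → ‖pc k‖ ≤ K * a ^ k) (hqc : ∀ k : ℕ, 1 ≤ k → ‖qc k‖ ≤ K * a ^ k)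
    (hres : ∀ n : ℕ, 1 ≤ n → μ * n ≤ ‖(n : ℂ) + pc 0‖)
    (hp : ∀ x : ℂ, ‖x‖ < ρ₀ → HasSum (fun k => x ^ k * pc k) (p x))
    (hq : ∀ x : ℂ, ‖x‖ < ρ₀ → HasSum (fun k => x ^ k * qc k) (q x))
    {y₀ y₁ : ℂ} (h0 : qc 0 * y₀ + pc 0 * y₁ = 0) :
    ∃ ρ : ℝ, 0 < ρ ∧ ∃ y y' : ℂ → ℂ, y 0 = y₀ ∧ y' 0 = y₁ ∧
      DifferentiableOn ℂ y (ball 0 ρ) ∧ DifferentiableOn ℂ y' (ball 0 ρ) ∧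
      (∀ x : ℂ, ‖x‖ < ρ → x ≠ 0 → HasDerivAt y (y' x) x) ∧
      ∀ x : ℂ, ‖x‖ < ρ → x * deriv y' x + p x * y' x + q x * y x = 0 := by
  have hD := isFrobeniusData_scalar pc qc ha hK hμ hpc hqc hres h0
  set M := scalarBranchM pc qc with hM
  set R := scalarBranchR pc qc with hR
  set c : ℝ := max 1 ((‖qc 0‖ + 1) / μ) with hc
  set K' : ℝ := 2 * K + a⁻¹ with hK'
  set lam : ℝ := a * (1 + 2 * c * K') with hlam
  set v : ℂ → ℂ × ℂ := frobeniusSol M (fun _ => 0) R (y₀, y₁) with hv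
  obtain ⟨hv0, -, hball, -⟩ := hD.analyticBranch
  have hlam0 : 0 ≤ lam := hD.a_le_lam.1
  have halam : a ≤ lam := hD.a_le_lam.2
  -- the radius
  set ρ : ℝ := min ρ₀ (1 / (lam + 1)) with hρ
  have hρpos : 0 < ρ := lt_min hρ₀ (by positivity)
  have hρ₁ : ∀ x : ℂ, ‖x‖ < ρ → ‖x‖ < ρ₀ := fun x hx => hx.trans_le (min_le_left _ _)
  have hρ₂ : ∀ x : ℂ, ‖x‖ < ρ → lam * ‖x‖ < 1 := fun x hx => by
    have h1 : ‖x‖ < 1 / (lam + 1) := hx.trans_le (min_le_right _ _)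
    rw [lt_div_iff₀ (by positivity)] at h1
    nlinarith [norm_nonneg x]
  have hρ₃ : ∀ x : ℂ, ‖x‖ < ρ → a * ‖x‖ < 1 := fun x hx =>
    lt_of_le_of_lt (mul_le_mul_of_nonneg_right halam (norm_nonneg x)) (hρ₂ x hx)
  -- the operator series evaluated
  have hMsum : ∀ x : ℂ, ‖x‖ < ρ → ∀ w : ℂ × ℂ,
      (∑' k, x ^ k • M k) w = (x * w.2, -(q x) * w.1 - p x * w.2) := by
    intro x hx w
    have hS : HasSum (fun k => x ^ k • M k) (∑' k, x ^ k • M k) :=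
      (summable_norm_pow_smul hD.norm_M_le' ha.le (hρ₃ x hx)).of_norm.hasSum
    have hSw : HasSum (fun k => (x ^ k • M k) w) ((∑' k, x ^ k • M k) w) := by
      have h := (ContinuousLinearMap.apply ℂ (ℂ × ℂ) w).hasSum hS
      simpa only [ContinuousLinearMap.apply_apply] using h
    have e1 : HasSum (fun k => ((x ^ k • M k) w).1) (x * w.2) := by
      have : (fun k => ((x ^ k • M k) w).1) = fun k => if k = 1 then x * w.2 else 0 := by
        funext k
        change (x ^ k • (M k w)).1 = _
        rw [hM, scalarBranchM_apply, Prod.smul_fst, smul_eq_mul]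
        split_ifs with hk
        · rw [hk, pow_one]
        · rw [mul_zero]
      rw [this]
      exact hasSum_ite_eq 1 (x * w.2)
    have e2 : HasSum (fun k => ((x ^ k • M k) w).2) (-(q x) * w.1 - p x * w.2) := by
      have : (fun k => ((x ^ k • M k) w).2) =
          fun k => -(x ^ k * qc k * w.1) - x ^ k * pc k * w.2 := by
        funext k
        change (x ^ k • (M k w)).2 = _
        rw [hM, scalarBranchM_apply, Prod.smul_snd, smul_eq_mul]
        ring
      rw [this]
      have h := ((hq x (hρ₁ x hx)).mul_right w.1).neg.sub ((hp x (hρ₁ x hx)).mul_right w.2)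
      have e : -(q x) * w.1 - p x * w.2 = -(q x * w.1) - p x * w.2 := by ring
      rw [e]
      exact h
    have e : HasSum (fun k => (x ^ k • M k) w) (x * w.2, -(q x) * w.1 - p x * w.2) := by
      simpa only [Prod.mk.eta] using e1.prodMk e2
    exact hSw.unique e
  refine ⟨ρ, hρpos, fun x => (v x).1, fun x => (v x).2, ?_, ?_, ?_, ?_, ?_, ?_⟩
  · show (v 0).1 = y₀
    rw [hv, hv0]
  · show (v 0).2 = y₁
    rw [hv, hv0]
  · intro x hx
    have hx' : x ∈ ball (0 : ℂ) ρ := hx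
    rw [Metric.mem_ball, dist_zero_right] at hx'
    exact ((hball x (hρ₂ x hx')).2.1.fst).differentiableWithinAt
  · intro x hx
    have hx' : x ∈ ball (0 : ℂ) ρ := hx
    rw [Metric.mem_ball, dist_zero_right] at hx'
    exact ((hball x (hρ₂ x hx')).2.1.snd).differentiableWithinAt
  · intro x hx hx0
    obtain ⟨-, hdiff, hode, -⟩ := hball x (hρ₂ x hx)
    have hd : HasDerivAt (fun y => (v y).1) ((deriv v x).1) x :=
      ((ContinuousLinearMap.fst ℂ ℂ ℂ).hasFDerivAt.comp_hasDerivAt x hdiff.hasDerivAt)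
    have key := congrArg Prod.fst hode
    rw [hMsum x hx, tsum_congr (fun k => smul_zero (x ^ k)), tsum_zero, add_zero] at key
    simp only [Prod.smul_fst, smul_eq_mul] at key
    have : (deriv v x).1 = (v x).2 := mul_left_cancel₀ hx0 key
    rwa [this] at hd
  · intro x hx
    obtain ⟨-, hdiff, hode, -⟩ := hball x (hρ₂ x hx)
    have hd : HasDerivAt (fun y => (v y).2) ((deriv v x).2) x :=
      ((ContinuousLinearMap.snd ℂ ℂ ℂ).hasFDerivAt.comp_hasDerivAt x hdiff.hasDerivAt)
    have key := congrArg Prod.snd hode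
    rw [hMsum x hx, tsum_congr (fun k => smul_zero (x ^ k)), tsum_zero, add_zero] at key
    simp only [Prod.smul_snd, smul_eq_mul] at key
    rw [hd.deriv, key]
    ring

end Literature.Analysis.ODE

end
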